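import Mathlib
import Literature.NumberTheory.LFunctions.Zhang2022.Section7dStatements
import HarnessLib

/-!
# Zhang (2022) §7 p. 40: `𝔯ⱼ` is the residue of `ζ(s+β₁)ζ(s+β₂)ζ(s+β₃)ζ(s)⁻¹δ(s)` at `s = 1 − β_j` — node `Z22:§7.u050`, DISCHARGED

Topic `Literature/NumberTheory/LFunctions/Zhang2022` (Landau–Siegel audit tree; verdict-neutral).
Y. Zhang, *Discrete mean estimates and the Landau–Siegel zero*, arXiv:2211.02515v1 (2022)
[Zhang2022LandauSiegel] — **an unrefereed manuscript under adjudication.** Cell siegel-zhang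
(D-0069), DISCHARGE of one proof-internal step of Proposition 7.1 (c) (§7 p. 40, tex L2118–L2126):
after moving the contour in (7.19) the manuscript collects "the residues of the integrand at
`s = 1 − β_j`, `1 ≤ j ≤ 3`", "where `𝔯ⱼ` is the residue of the function
`ζ(s+β₁)ζ(s+β₂)ζ(s+β₃)ζ(s)⁻¹δ(s)` at `s = 1 − β_j`". The typing (L2-t5, p412033) DEFINES `𝔯ⱼ` by its
value `frakr c′ D j = ζ(1−β_j+β_{j+1})ζ(1−β_j+β_{j+2})δ(1−β_j)/ζ(1−β_j)` (indices mod 3) and records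
as the CLAIM `Section7dStatements.Step7u050 c′` that this IS the residue:
`(s − (1−β_j))·resFn(s) → frakr j` on the punctured neighbourhood of `1 − β_j`, for `D` large and
`j = 1, 2, 3` (`resFn = zetaRatio · δ`, `δ = Skeleton.deltaW`, (5.14)).
**This file proves it**: `Section7dStatements.step7u050_holds : ∀ c′, Step7u050 c′`, with the
explicit threshold `D ≥ ⌈exp(20π|c′| + 3)⌉` (so that `α = π𝓛⁻⁹ > 0` and `|c′α𝓛| ≤ 1/20`, whence
`0 < b₁ < b₂ < b₃` for the shift sizes `β_j = ib_j` of (2.13): the three poles are distinct and off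
`s = 1`). Theorems only; 0 new facts.

## Proof

`tendsto_residue`: for `b ≠ 0`, `b′, b″ ≠ b`, `ζ(1−b) ≠ 0` and `δ` continuous at `1 − b`,
`(s − (1−b))ζ(s+b)ζ(s+b′)ζ(s+b″)ζ(s)⁻¹δ(s) → ζ(1−b+b′)ζ(1−b+b″)δ(1−b)/ζ(1−b)` — the simple pole of
`ζ` at `1` with residue `1` (Mathlib's `riemannZeta_residue_one`, transported by `s ↦ s + b`) times
the continuous cofactor (`ζ` holomorphic off `1`; `ζ ≠ 0` on `Re s = 1`,
`riemannZeta_ne_zero_of_one_le_re`; `δ` holomorphic on `Re s > 0` by the tree's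
`Lemma53.differentiableOn_delta514`, `𝓛₂ = 𝓛⁴⁰⁰ ≥ 1`). The node follows for `j = 1, 2, 3` by
reordering the three `ζ`-factors.

WHAT THIS IS NOT: any statement about Theorems 1–2 of the manuscript or about Landau–Siegel zeros;
a discharge of the contour move `Step7u047`/`Step7u049` or of the residue asymptotics
`Step7u058`–`Step7u060` (`i𝔯ⱼp^{−β_j} = w_j/α + O(𝓛)`), which USE this identification.

## References

* Y. Zhang, arXiv:2211.02515v1 (2022), §7 p. 40, tex L2118–L2126; §2 (2.13); §5 (5.14).
  [cite: Zhang2022LandauSiegel, §7 p.40]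
-/

noncomputable section

open Complex Filter Topology

namespace Literature.NumberTheory.LFunctions.Zhang2022.Residue750

/-! ### §1. The residue of a triple `ζ`-product with a simple pole from one factor -/

/-- Translation maps the punctured neighbourhood of `1 − b` onto that of `1`. [folklore] -/
private theorem tendsto_add_punctured (b : ℂ) :
    Tendsto (fun s : ℂ => s + b) (𝓝[≠] (1 - b)) (𝓝[≠] 1) := by
  refine tendsto_nhdsWithin_of_tendsto_nhds_of_eventually_within _ ?_ ?_
  · have : Tendsto (fun s : ℂ => s + b) (𝓝 (1 - b)) (𝓝 (1 - b + b)) :=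
      (continuous_add_const b).tendsto _
    rw [sub_add_cancel] at this
    exact this.mono_left nhdsWithin_le_nhds
  · refine eventually_nhdsWithin_of_forall fun s hs => ?_
    simp only [Set.mem_compl_iff, Set.mem_singleton_iff] at hs ⊢
    intro h; exact hs (by rw [← h]; ring)

/-- **The residue computation.** Let `δ` be continuous at `s₀ = 1 − b`, let `b′ ≠ b`, `b″ ≠ b`, and
`ζ(1 − b) ≠ 0`. Then `(s − s₀)·ζ(s+b)ζ(s+b′)ζ(s+b″)ζ(s)⁻¹δ(s) → ζ(1−b+b′)ζ(1−b+b″)δ(1−b)/ζ(1−b)`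
as `s → s₀`, `s ≠ s₀`: the simple pole of `ζ(s+b)` (residue `1`, Mathlib's
`riemannZeta_residue_one`) times the value of the holomorphic cofactor.
[cite: Zhang2022LandauSiegel, §7 p.40, tex L2122] -/
theorem tendsto_residue {b b' b'' : ℂ} {δ : ℂ → ℂ} (hb : b ≠ 0) (hb' : b' ≠ b) (hb'' : b'' ≠ b)
    (hζ : riemannZeta (1 - b) ≠ 0) (hδ : ContinuousAt δ (1 - b)) :
    Tendsto (fun s : ℂ => (s - (1 - b)) *
        (riemannZeta (s + b) * riemannZeta (s + b') * riemannZeta (s + b'') / riemannZeta s * δ s))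
      (𝓝[≠] (1 - b))
      (𝓝 (riemannZeta (1 - b + b') * riemannZeta (1 - b + b'') * δ (1 - b) / riemannZeta (1 - b))) := by
  -- the polar factor
  have hres : Tendsto (fun s : ℂ => (s + b - 1) * riemannZeta (s + b)) (𝓝[≠] (1 - b)) (𝓝 1) :=
    riemannZeta_residue_one.comp (tendsto_add_punctured b)
  -- the holomorphic cofactor
  have h0 : (1 : ℂ) - b ≠ 1 := fun h => hb (by linear_combination -h)
  have h1 : (1 : ℂ) - b + b' ≠ 1 := fun h => hb' (by linear_combination h)
  have h2 : (1 : ℂ) - b + b'' ≠ 1 := fun h => hb'' (by linear_combination h)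
  have hc : ContinuousAt (fun s : ℂ => riemannZeta (s + b') * riemannZeta (s + b'') * δ s /
      riemannZeta s) (1 - b) := by
    refine ((ContinuousAt.mul (ContinuousAt.mul ?_ ?_) hδ).div
      (differentiableAt_riemannZeta h0).continuousAt hζ)
    · exact (differentiableAt_riemannZeta h1).continuousAt.comp_of_eq
        (continuous_add_const b').continuousAt rfl
    · exact (differentiableAt_riemannZeta h2).continuousAt.comp_of_eq
        (continuous_add_const b'').continuousAt rfl
  have key := hres.mul (hc.tendsto.mono_left nhdsWithin_le_nhds)
  rw [one_mul] at key
  exact key.congr fun s => by ring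

/-! ### §2. The shifts `β_j` for large `D`: non-zero, pairwise distinct, purely imaginary -/

section Shifts

variable (c' : ℝ) (D : ℕ)

/-- `β₁ = i b₁`. [cite: Zhang2022LandauSiegel, §2 (2.13)] -/
private theorem beta1_eq : Skeleton.beta1 c' D = I * (Skeleton.b1 c' D : ℂ) := by
  rw [Skeleton.beta1, Skeleton.b1]; push_cast; ring

/-- `β₂ = i b₂`. [cite: Zhang2022LandauSiegel, §2 (2.13)] -/
private theorem beta2_eq : Skeleton.beta2 c' D = I * (Skeleton.b2 c' D : ℂ) := by
  rw [Skeleton.beta2, Skeleton.b2]; push_cast; ring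

/-- `β₃ = i b₃`. [cite: Zhang2022LandauSiegel, §2 (2.13)] -/
private theorem beta3_eq : Skeleton.beta3 c' D = I * (Skeleton.b3 c' D : ℂ) := by
  rw [Skeleton.beta3, Skeleton.b3]; push_cast; ring

/-- `i r ≠ i r'` for distinct reals. [folklore] -/
private theorem I_mul_ne {r r' : ℝ} (h : r ≠ r') : I * (r : ℂ) ≠ I * (r' : ℂ) := fun e =>
  h (Complex.ofReal_injective (mul_left_cancel₀ Complex.I_ne_zero e))

/-- `ζ(1 − i r) ≠ 0` (no zeros on `Re s = 1`). [folklore] -/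
private theorem zeta_one_sub_ne_zero (r : ℝ) : riemannZeta (1 - I * (r : ℂ)) ≠ 0 :=
  riemannZeta_ne_zero_of_one_le_re (by simp)

variable {c' D}

/-- **The shift sizes for `D` large**: if `α > 0` and `|c′αℓ| ≤ 1/20` then
`0 < b₁ < b₂ < b₃` (`b₁ = α(1−5c′αℓ)`, `b₂ = 2α(1+c′αℓ)`, `b₃ = 3α(1−c′αℓ)`).
[cite: Zhang2022LandauSiegel, §2 (2.13)] -/
theorem b_chain (hα : 0 < Skeleton.alpha D) (ht : |c' * Skeleton.alpha D * Skeleton.ell D| ≤ 1 / 20) :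
    0 < Skeleton.b1 c' D ∧ Skeleton.b1 c' D < Skeleton.b2 c' D ∧ Skeleton.b2 c' D < Skeleton.b3 c' D := by
  set t := c' * Skeleton.alpha D * Skeleton.ell D with htdef
  have ht' := abs_le.mp ht
  have e1 : Skeleton.b1 c' D = Skeleton.alpha D * (1 - 5 * t) := by rw [Skeleton.b1, htdef]; ring
  have e2 : Skeleton.b2 c' D = Skeleton.alpha D * (2 + 2 * t) := by rw [Skeleton.b2, htdef]; ring
  have e3 : Skeleton.b3 c' D = Skeleton.alpha D * (3 - 3 * t) := by rw [Skeleton.b3, htdef]; ring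
  rw [e1, e2, e3]
  refine ⟨mul_pos hα (by linarith), ?_, ?_⟩
  · exact mul_lt_mul_of_pos_left (by linarith) hα
  · exact mul_lt_mul_of_pos_left (by linarith) hα

/-- A threshold beyond which `log D ≥ 3` and `|c′|αℓ ≤ 1/20` (`αℓ = πℓ⁻⁸`).
[cite: Zhang2022LandauSiegel, §2 p.4] -/
theorem large_D {D : ℕ} (hD : ⌈Real.exp (20 * Real.pi * |c'| + 3)⌉₊ ≤ D) :
    3 ≤ Skeleton.ell D ∧ 0 < Skeleton.alpha D ∧
      |c' * Skeleton.alpha D * Skeleton.ell D| ≤ 1 / 20 := by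
  have hexp : Real.exp (20 * Real.pi * |c'| + 3) ≤ D := le_trans (Nat.le_ceil _) (by exact_mod_cast hD)
  have hD0 : (0 : ℝ) < D := lt_of_lt_of_le (Real.exp_pos _) hexp
  have hlog : 20 * Real.pi * |c'| + 3 ≤ Real.log D := (Real.le_log_iff_exp_le hD0).mpr hexp
  have hπ : 0 < Real.pi := Real.pi_pos
  have hc0 : 0 ≤ 20 * Real.pi * |c'| := by positivity
  have hL3 : 3 ≤ Skeleton.ell D := by rw [Skeleton.ell]; linarith
  have hL1 : 1 ≤ Skeleton.ell D := by linarith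
  have hL0 : 0 < Skeleton.ell D := by linarith
  have hα : Skeleton.alpha D = Real.pi / Skeleton.ell D ^ 9 := by
    rw [Skeleton.alpha, Skeleton.bigP, Real.log_exp]
  have hαpos : 0 < Skeleton.alpha D := by rw [hα]; positivity
  refine ⟨hL3, hαpos, ?_⟩
  have hL8 : 20 * Real.pi * |c'| ≤ Skeleton.ell D ^ 8 := by
    calc 20 * Real.pi * |c'| ≤ Skeleton.ell D := by rw [Skeleton.ell]; linarith
      _ = Skeleton.ell D ^ 1 := (pow_one _).symm
      _ ≤ Skeleton.ell D ^ 8 := pow_le_pow_right₀ hL1 (by norm_num)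
  have hpow : (0 : ℝ) < Skeleton.ell D ^ 8 := by positivity
  rw [abs_mul, abs_mul, abs_of_pos hαpos, abs_of_pos hL0, hα]
  rw [show |c'| * (Real.pi / Skeleton.ell D ^ 9) * Skeleton.ell D =
      Real.pi * |c'| / Skeleton.ell D ^ 8 by field_simp]
  rw [div_le_iff₀ hpow]
  linarith

end Shifts

/-! ### §3. The node `Z22:§7.u050` -/

/-- `β_j` for `j = 1, …, 5` (the convention `β₄ = β₁`, `β₅ = β₂`). [cite: Zhang2022LandauSiegel, §8 p.45] -/
private theorem betaJ_vals (c' : ℝ) (D : ℕ) :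
    Skeleton.betaJ c' D 1 = Skeleton.beta1 c' D ∧ Skeleton.betaJ c' D 2 = Skeleton.beta2 c' D ∧
      Skeleton.betaJ c' D 3 = Skeleton.beta3 c' D ∧ Skeleton.betaJ c' D 4 = Skeleton.beta1 c' D ∧
      Skeleton.betaJ c' D 5 = Skeleton.beta2 c' D := by
  simp [Skeleton.betaJ]

/-- **`Z22:§7.u050` DISCHARGED** (§7 p. 40, tex L2122–L2126): "`𝔯ⱼ` is the residue of the function
`ζ(s+β₁)ζ(s+β₂)ζ(s+β₃)ζ(s)⁻¹δ(s)` at `s = 1 − β_j`" — as typed by `Section7dStatements.Step7u050`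
(`(s − (1 − β_j))·resFn(s) → 𝔯ⱼ = frakr j` on the punctured neighbourhood), for all `D` beyond an
explicit threshold (`log D ≥ 20π|c′| + 3`, so that `α > 0` and the three shifts are non-zero and
pairwise distinct), every `χ`, and `j = 1, 2, 3`. Proof: the pole of `ζ(s+β_j)` is simple with
residue `1` (`riemannZeta_residue_one`); the cofactor `ζ(s+β_{j+1})ζ(s+β_{j+2})δ(s)/ζ(s)` is
continuous at `1 − β_j` (`ζ` holomorphic off `1`, `ζ(1 − β_j) ≠ 0` on `Re s = 1`, `δ` holomorphic
on `Re s > 0` by the tree's `Lemma53.differentiableOn_delta514`).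
[cite: Zhang2022LandauSiegel, §7 p.40, tex L2122] -/
theorem _root_.Literature.NumberTheory.LFunctions.Zhang2022.Section7dStatements.step7u050_holds
    (c' : ℝ) : Section7dStatements.Step7u050 c' := by
  refine ⟨⌈Real.exp (20 * Real.pi * |c'| + 3)⌉₊, fun D _ χ hD _ _ => ?_⟩
  obtain ⟨hL3, hα, ht⟩ := large_D (c' := c') hD
  obtain ⟨hb1, hb12, hb23⟩ := b_chain hα ht
  have hL2 : 1 ≤ Skeleton.ell2 D := by
    rw [Skeleton.ell2]; exact one_le_pow₀ (by linarith)
  -- continuity of `δ` on `Re s = 1`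
  have hδ : ∀ r : ℝ, ContinuousAt (Skeleton.deltaW D) (1 - I * (r : ℂ)) := fun r => by
    have hmem : (1 - I * (r : ℂ)) ∈ {s : ℂ | 0 < s.re} := by simp
    have hd := (Lemma53.differentiableOn_delta514 hL2 (Skeleton.t0 D)).differentiableAt
      ((isOpen_lt continuous_const Complex.continuous_re).mem_nhds hmem)
    exact hd.continuousAt
  have e1 := beta1_eq c' D
  have e2 := beta2_eq c' D
  have e3 := beta3_eq c' D
  have n1 : Skeleton.beta1 c' D ≠ 0 := by rw [e1]; simpa using I_mul_ne hb1.ne'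
  have n2 : Skeleton.beta2 c' D ≠ 0 := by rw [e2]; simpa using I_mul_ne (hb1.trans hb12).ne'
  have n3 : Skeleton.beta3 c' D ≠ 0 := by
    rw [e3]; simpa using I_mul_ne ((hb1.trans hb12).trans hb23).ne'
  have n12 : Skeleton.beta2 c' D ≠ Skeleton.beta1 c' D := by rw [e1, e2]; exact I_mul_ne hb12.ne'
  have n13 : Skeleton.beta3 c' D ≠ Skeleton.beta1 c' D := by
    rw [e1, e3]; exact I_mul_ne (hb12.trans hb23).ne'
  have n23 : Skeleton.beta3 c' D ≠ Skeleton.beta2 c' D := by rw [e2, e3]; exact I_mul_ne hb23.ne'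
  have z1 : riemannZeta (1 - Skeleton.beta1 c' D) ≠ 0 := by rw [e1]; exact zeta_one_sub_ne_zero _
  have z2 : riemannZeta (1 - Skeleton.beta2 c' D) ≠ 0 := by rw [e2]; exact zeta_one_sub_ne_zero _
  have z3 : riemannZeta (1 - Skeleton.beta3 c' D) ≠ 0 := by rw [e3]; exact zeta_one_sub_ne_zero _
  have d1 : ContinuousAt (Skeleton.deltaW D) (1 - Skeleton.beta1 c' D) := by rw [e1]; exact hδ _
  have d2 : ContinuousAt (Skeleton.deltaW D) (1 - Skeleton.beta2 c' D) := by rw [e2]; exact hδ _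
  have d3 : ContinuousAt (Skeleton.deltaW D) (1 - Skeleton.beta3 c' D) := by rw [e3]; exact hδ _
  obtain ⟨j1, j2, j3, j4, j5⟩ := betaJ_vals c' D
  intro j hj
  rw [Finset.mem_Icc] at hj
  obtain ⟨hj1, hj3⟩ := hj
  interval_cases j
  · simp only [Section7dStatements.resFn, Section7dStatements.zetaRatio, Section7dStatements.frakr,
      j1, j2, j3]
    exact tendsto_residue n1 n12 n13 z1 d1
  · simp only [Section7dStatements.resFn, Section7dStatements.zetaRatio, Section7dStatements.frakr,
      j2, j3, j4]
    exact (tendsto_residue n2 n23 n12.symm z2 d2).congr fun s => by ring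
  · simp only [Section7dStatements.resFn, Section7dStatements.zetaRatio, Section7dStatements.frakr,
      j3, j4, j5]
    exact (tendsto_residue n3 n13.symm n23.symm z3 d3).congr fun s => by ring

variable (c' : ℝ) in
/-- `Step7u050` — `_holds` alias of `step7u050_holds` above under the fact's exact name, stated under the
prover's own binders as section variables (appended 2026-08-28, D-0026 bookkeeping: the proof term is the
existing theorem of this file; no statement, definition or attribute is edited; no new named fact; the
ledger's debt table listed the fact unproved). [cite: Zhang2022LandauSiegel, §7 p.40, tex L2122] -/
theorem _root_.Literature.NumberTheory.LFunctions.Zhang2022.Section7dStatements.Step7u050_holds :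
    _root_.Literature.NumberTheory.LFunctions.Zhang2022.Section7dStatements.Step7u050 c' :=
  _root_.Literature.NumberTheory.LFunctions.Zhang2022.Section7dStatements.step7u050_holds (c' := c')

end Literature.NumberTheory.LFunctions.Zhang2022.Residue750
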